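import Mathlib
import Summits.Ventures.PercRepro2.KPrimeTiltE

/-!
# The repaired hypothesis `(e′)` of the tilt step: `(e) ⟹ (e′) ⟹ (TILT)`
(blind cell PercRepro2, mine-c g40; `conjectures/MINE-C.md` §49.1–49.2)

Fact `(e)` of `MINE-C.md` §47.8 (`0 ≤ factEForm`, `KPrimeTiltE.lean`) is FALSE (NEG-220: exact witnesses
at `n = 6`, a vertex `v` pendant at a vertex `w` through a light edge), so `tiltForm_nonneg_of_factEForm_nonneg`
is a valid implication with a false hypothesis.  With the same masses as `KPrimeTiltE.lean`
(`Sm = P(S)`, `YS = P(Y ∩ S)`, `D₀ = P(N)`, `(a) = P((0,1) ∩ Z̄)·D₀ − P((0,1))·D₀_Z̄`, the theorem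
`cls01_avoid_a2_pa_harris'`):

* `ePrimeForm := YS · (a) + factEForm` is the cleared form of the one-world candidate
  `(e′)`: `Cov_S(m·(γ − c), g) ≥ 0` with `m(L) = P_{G∖L}(a₁ ↔ {v, y})`, `g = 1[y ∉ L]`, `γ = 1[z ∉ L]`,
  `c = P(Z̄ | N)` (`MINE-C.md` §49.2 (b): `(e′) = (e)-term + ν·(a)-term`, `ν = YS/Sm`; `(e′)` is
  `0 ≤ ePrimeForm`);
* **`tiltForm_eq_ePrimeForm`**: `tiltForm = ePrimeForm + (Sm − YS) · (a)`, so
  **`tiltForm_nonneg_of_ePrimeForm_nonneg`**: `(TILT)` follows from `(e′)` (`YS ≤ Sm` and `(a) ≥ 0`);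
* **`ePrimeForm_nonneg_of_factEForm_nonneg`**: `(e)` implies `(e′)` — the chain `(e) ⟹ (e′) ⟹ (TILT)`.

`(e′)` is census-true (climbs reach equality loci from above only) and, unlike `(e)`, survives the pendant
instrument: its `p → 0` limit is `Cov_Ω(P_{G∖L}(a₁ ↔ y), γ) ≥ 0`, a BHK 1.3 fact.  It is a CANDIDATE, not a
theorem; nothing here asserts it.
-/

namespace Summit.Ventures.PercRepro2

namespace KPrime

variable {V : Type*} {E : Type*} [Fintype E] [DecidableEq E] [Fintype V] [DecidableEq V]
  {R : Type*} [Field R] [LinearOrder R] [IsStrictOrderedRing R]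

section Statements

variable (ends : E → Sym2 V) (a₁ a₂ v y z : V) (p : E → R)

/-- **The candidate `(e′)`** of `MINE-C.md` §49.2 (b) as a cleared form (`(e′)` is `0 ≤ ePrimeForm`):
`YS · (P((0,1) ∩ Z̄)·P(N) − P((0,1))·P(N ∩ Z̄)) + factEForm`. -/
noncomputable def ePrimeForm : R :=
  prob p (connEvent ends a₂ y ∩ S ends a₁ a₂ v) *
      (prob p (cls01 ends a₁ a₂ v y ∩ avoidAll ends a₂ {z}) * prob p (N ends a₁ a₂ v) -
        prob p (cls01 ends a₁ a₂ v y) * prob p (N ends a₁ a₂ v ∩ avoidAll ends a₂ {z})) +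
    factEForm ends a₁ a₂ v y z p

end Statements

section Chain

variable {ends : E → Sym2 V} {a₁ a₂ v y z : V} {p : E → R}

omit [Fintype V] in
/-- **`(TILT) = (e′) + (Sm − YS) · (a)`**. -/
theorem tiltForm_eq_ePrimeForm :
    tiltForm ends a₁ a₂ v y z p =
      ePrimeForm ends a₁ a₂ v y z p +
        (prob p (S ends a₁ a₂ v) - prob p (connEvent ends a₂ y ∩ S ends a₁ a₂ v)) *
          (prob p (cls01 ends a₁ a₂ v y ∩ avoidAll ends a₂ {z}) * prob p (N ends a₁ a₂ v) -
            prob p (cls01 ends a₁ a₂ v y) * prob p (N ends a₁ a₂ v ∩ avoidAll ends a₂ {z})) := by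
  rw [tiltForm_eq]
  unfold ePrimeForm
  ring

/-- **`(TILT)` follows from `(e′)`**: `YS ≤ Sm` and fact `(a)` (`cls01_avoid_a2_pa_harris'`). -/
theorem tiltForm_nonneg_of_ePrimeForm_nonneg (hp : IsProbVec p) (hza₂ : z ≠ a₂)
    (he : 0 ≤ ePrimeForm ends a₁ a₂ v y z p) : 0 ≤ tiltForm ends a₁ a₂ v y z p := by
  rw [tiltForm_eq_ePrimeForm]
  have ha := cls01_avoid_a2_pa_harris' (ends := ends) (a₁ := a₁) (v := v) (y := y) hp hza₂
  have hYS : prob p (connEvent ends a₂ y ∩ S ends a₁ a₂ v) ≤ prob p (S ends a₁ a₂ v) :=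
    prob_mono hp Set.inter_subset_right
  exact add_nonneg he (mul_nonneg (sub_nonneg.2 hYS) (sub_nonneg.2 ha))

/-- **`(e)` implies `(e′)`**: `YS ≥ 0` and fact `(a)`. -/
theorem ePrimeForm_nonneg_of_factEForm_nonneg (hp : IsProbVec p) (hza₂ : z ≠ a₂)
    (he : 0 ≤ factEForm ends a₁ a₂ v y z p) : 0 ≤ ePrimeForm ends a₁ a₂ v y z p := by
  unfold ePrimeForm
  have ha := cls01_avoid_a2_pa_harris' (ends := ends) (a₁ := a₁) (v := v) (y := y) hp hza₂
  have hYS : 0 ≤ prob p (connEvent ends a₂ y ∩ S ends a₁ a₂ v) := prob_nonneg hp _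
  exact add_nonneg (mul_nonneg hYS (sub_nonneg.2 ha)) he

end Chain

end KPrime

end Summit.Ventures.PercRepro2
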